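import Summits.BirchSwinnertonDyer.BirchSwinnertonDyer.Theorems.PrintX9MuPartStabilizedCoherentPairOfCyclic
import Summits.BirchSwinnertonDyer.BirchSwinnertonDyer.Theorems.PrintX10bHowardContainmentLightFrameX10bOfMuCoherentPair
import HarnessLib

/-!
# Row-10 TWIN of the shared skeleton v2 (`Cruxes/MuInequalityCoherentPair/Lines/spec_witnesses.lean`, μ LEAD x9-p1 g3)
# on the row-10 crux of record `PrintX10b.HowardContainmentLightFrameX10bPinnedOfPrint` (stmt-BirchSwinnertonDyer-27275,
# SPLIT gen 2 by THE CUT v2: shared μ-crux 22642 `MuInequalityCoherentPair` OPEN · support 22643 `PrintHypothesesDischargeX10b`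
# proved (p649419) · glue 22644 proved (p649419)) — x10b-p2 LEAD g5

SAME SINGLE STUB, SAME LETTER as the shared skeleton: `stub_portCyclic : Stmt.portCyclic` (copied byte-for-byte, so ONE
landing serves both registrations).  Composition for row 10, all BY NAME over accepted files:
crux 27275 ⟸ p631887 `PrintX10bSharpMuCoherentPair.howardContainmentLightFrameX10bPinnedOfPrint_of_muPartStabilizedCoherentPair`
⟸ L∃ `HeegnerMuPartStabilized.MuPartStabilizedCoherentPair` (= the shared crux letter 22642 verbatim)
⟸ p644084 `HeegnerMuPartStabilized.muPartStabilizedCoherentPair_of_forall_cyclic` ⟸ `stub_portCyclic`.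
ONE `sorry` (the stub).  `HowardContainmentLightFrameX10bPinnedOfPrint_of` concludes the row-10 crux BY NAME.
Route file imported only through p631887's module (it concludes a `Theses.PrintX10b` decl).  BEYOND CITABLE PRINT at
`p ∣ h_K` (REF-118).  No summit statement is proved; BSD is NOT proved by this file.
-/

set_option linter.dupNamespace false
set_option autoImplicit false

noncomputable section

open scoped Classical Pointwise

open Literature Literature.NumberTheory.EllipticCurves WeierstrassCurve
open Summit.BirchSwinnertonDyer.BirchSwinnertonDyer.Theorems

namespace Summit.BirchSwinnertonDyer.BirchSwinnertonDyer.Cruxes.HowardContainmentAnyClassNumberX10b.CoherentPairX10b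

/-- **Letter of `stub_portCyclic`** — byte-identical with the shared skeleton v2's `Stmt.portCyclic`
(`Cruxes/MuInequalityCoherentPair/Lines/spec_witnesses.lean`): the CYCLIC PORT STATEMENT (hypothesis of p644084's
`HeegnerMuPartStabilized.muPartStabilizedCoherentPair_of_forall_cyclic`). -/
abbrev Stmt.portCyclic : Prop :=
  ∀ (N : ℕ) [NeZero N] (W : WeierstrassCurve ℚ) [W.IsGloballyMinimal] (K : Type) [Field K] [NumberField K]
    (p : ℕ) [Fact p.Prime] (κ : ZpExtension K p) (γ : Field.absoluteGaloisGroup K)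
    (jbar : AlgebraicClosure K →+* ℂ),
    CastellaGrossiLeeSkinner2022.Thm413Hypotheses N W K p κ γ →
    ¬ W.HasCM → W.HasIrreducibleModPGaloisRep p → (W.baseChange K).HasIrreducibleModPGaloisRep p →
    MastellaZerman2026.HasPadicScalarImage W p → SatisfiesHeegnerHypothesis p K →
    p ∣ NumberField.classNumber K →
    ∀ (D : (W.baseChange K).LambdaAdicSelmerData κ γ)
      (C : CastellaGrossiLeeSkinner2022.StabilizedHeegnerData N W K κ jbar)
      (X : (W.baseChange K).SelmerDualData κ γ) (z : D.S),
    (∀ (k : ℕ) (hk : C.depth < k), D.proj k z ∈ CastellaGrossiLeeSkinner2022.stabilizedClassLayer C k hk) →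
    CastellaGrossiLeeSkinner2022.stabilizedHeegnerModule D C = Submodule.span (IwasawaAlgebra p) {z} →
    Module.Finite (IwasawaAlgebra p) D.S → Module.Finite (IwasawaAlgebra p) X.X →
    Module.IsTorsion (IwasawaAlgebra p) (D.S ⧸ CastellaGrossiLeeSkinner2022.stabilizedHeegnerModule D C) →
    HeegnerMuPartStabilized.HasSpecWitnesses p D.S X.X (CastellaGrossiLeeSkinner2022.stabilizedHeegnerModule D C)

/-! ## Stub (shared with the μ-crux skeleton) -/

/-- `stub_portCyclic` — OPEN; the SAME stub as the shared skeleton v2 on stmt-BirchSwinnertonDyer-22642 (road R1′: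
Howard 2004 Thm. 1.6.1 cited on `eisensteinDVRSetting`, KS by `KolyvaginSystem.ofHom`, control/glue into p643969). -/
theorem stub_portCyclic : Stmt.portCyclic := by
  sorry

/-! ## Composition: the row-10 crux BY NAME -/

/-- The shared μ-crux letter from the stub (p644084). -/
theorem muPartStabilizedCoherentPair_of_stub : HeegnerMuPartStabilized.MuPartStabilizedCoherentPair :=
  HeegnerMuPartStabilized.muPartStabilizedCoherentPair_of_forall_cyclic stub_portCyclic

/-- **Row 10's crux of record from the single shared stub**: `PrintX10b.HowardContainmentLightFrameX10bPinnedOfPrint`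
over p631887 (print inputs discharged inside p631887: X10 frame ⇒ Thm413Hypotheses, irreducibility, scalar image). -/
theorem HowardContainmentLightFrameX10bPinnedOfPrint_of :
    Summit.BirchSwinnertonDyer.BirchSwinnertonDyer.Theses.PrintX10b.HowardContainmentLightFrameX10bPinnedOfPrint :=
  PrintX10bSharpMuCoherentPair.howardContainmentLightFrameX10bPinnedOfPrint_of_muPartStabilizedCoherentPair
    muPartStabilizedCoherentPair_of_stub

end Summit.BirchSwinnertonDyer.BirchSwinnertonDyer.Cruxes.HowardContainmentAnyClassNumberX10b.CoherentPairX10b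

end
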